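import Summits.ValiantsHypothesis.ValiantsHypothesis.Theorems.KPlusLogSqLawTropicalBStaticFourCover

/-!
# `TropicalB` (stmt-ValiantsHypothesis-19771) — the static `4 × 4` cell: SOUNDNESS of the orbit-cover enumeration

Cell `pub-symmetroid`, seat val-sym-trop-p4 (g7).  HONEST FRAMING: pure finite combinatorics, companion of `…StaticFourCover` (the kernel
run `coverCheck`).  `cover`: every `16`-subset `V` of `Fin 24` (indices of `P24`) containing no full parallelogram quad of `quadT` is carried by
some `(π, ρ, τ)` onto some representative: `repT r s' ↔ ∃ s ∈ V, actN π ρ τ s = s'`.  Proof: the enumeration `enumL idata` visits, along the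
branch dictated by `V`, a leaf whose mask is exactly `V` (members force the IN branch — fewer than `16` so far, and no quad completed because `V`
is quad-free — non-members force the OUT branch), and a leaf passes only if its certificate carries the mask onto a representative mask.
Nothing here bears on `TropicalB` in its window, `WeakLifting`, `MatrixDescartes` (stmt-ValiantsHypothesis-18050) or VP ≠ VNP.
[this seat]
-/

set_option linter.dupNamespace false
set_option autoImplicit false

namespace Summit.ValiantsHypothesis.ValiantsHypothesis.Theorems.KPlusLogSqLaw.StaticFourQuad

open Finset

/-! ### 1. Table facts -/

/-- the corner set of a quad, as a predicate on naturals. -/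
def IsCorner (q : Fin 24 × Fin 24 × Fin 24 × Fin 24) (j : ℕ) : Prop :=
  j = q.1 ∨ j = q.2.1 ∨ j = q.2.2.1 ∨ j = q.2.2.2

/-- `IsCorner q j` is a finite disjunction of equalities, hence decidable (used by the `decide`d table fact below). -/
instance instDecidableIsCorner (q : Fin 24 × Fin 24 × Fin 24 × Fin 24) (j : ℕ) : Decidable (IsCorner q j) := by
  unfold IsCorner; infer_instance

/-- the index data lists the indices `0, …, 23` in order. -/
theorem idata_fst : idata.map Prod.fst = List.range 24 := by decide

/-- the index data has length `24`. -/
theorem idata_length : idata.length = 24 := by decide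

/-- each mask of the index data of `i` is the set of the other three corners of a quad through `i`. -/
theorem idata_quads : ∀ e ∈ idata, ∀ m ∈ [e.2.1, e.2.2.1, e.2.2.2], ∃ q ∈ quadT,
    IsCorner q e.1 ∧ ∀ j < 24, (m.testBit j = true ↔ (IsCorner q j ∧ j ≠ e.1)) := by
  decide +kernel

/-! ### 2. Bits -/

/-- bits of a folded image mask. -/
theorem testBit_foldl_range (P : ℕ → Bool) (f : ℕ → ℕ) (L : List ℕ) (acc : ℕ) (j : ℕ) :
    ((L.foldl (fun acc s => if P s then acc ||| 2 ^ f s else acc) acc).testBit j = true) ↔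
      (acc.testBit j = true ∨ ∃ s ∈ L, P s = true ∧ f s = j) := by
  induction L generalizing acc with
  | nil => simp
  | cons a L ih =>
    rw [List.foldl_cons, ih]
    constructor
    · rintro (h | ⟨s, hs, hP, hf⟩)
      · by_cases ha : P a = true
        · rw [if_pos ha, Nat.testBit_or] at h
          rcases Bool.or_eq_true_iff.1 h with h | h
          · exact Or.inl h
          · refine Or.inr ⟨a, by simp, ha, ?_⟩
            by_contra hne
            rw [Nat.testBit_two_pow_of_ne hne] at h
            exact Bool.false_ne_true h
        · rw [if_neg ha] at h
          exact Or.inl h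
      · exact Or.inr ⟨s, by simp [hs], hP, hf⟩
    · rintro (h | ⟨s, hs, hP, hf⟩)
      · left
        by_cases ha : P a = true
        · rw [if_pos ha, Nat.testBit_or, h]; simp
        · rw [if_neg ha]; exact h
      · rcases List.mem_cons.1 hs with rfl | hs
        · left
          rw [if_pos hP, Nat.testBit_or, ← hf, Nat.testBit_two_pow_self]; simp
        · exact Or.inr ⟨s, hs, hP, hf⟩

/-- bits of the image mask. -/
theorem testBit_imageMask (π ρ : Fin 24) (τ : Bool) (M : ℕ) (j : ℕ) :
    (imageMask π ρ τ M).testBit j = true ↔ ∃ s < 24, M.testBit s = true ∧ actN π ρ τ s = j := by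
  unfold imageMask
  rw [testBit_foldl_range]
  simp [List.mem_range]

/-- `M &&& m = m` means the bits of `m` are bits of `M`. -/
theorem testBit_of_and_eq {M m : ℕ} (h : M &&& m = m) {j : ℕ} (hj : m.testBit j = true) : M.testBit j = true := by
  have := congrArg (fun x => x.testBit j) h
  simp only [Nat.testBit_and, hj, Bool.and_true] at this
  exact this

/-! ### 3. Soundness of the enumeration -/

/-- elements below `i`, as a filter. -/
theorem card_filter_lt_succ_of_mem {V : Finset (Fin 24)} {i : ℕ} (hi : i < 24) (h : (⟨i, hi⟩ : Fin 24) ∈ V) :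
    (V.filter fun s : Fin 24 => s.val < i + 1).card = (V.filter fun s : Fin 24 => s.val < i).card + 1 := by
  have : (V.filter fun s : Fin 24 => s.val < i + 1) = insert ⟨i, hi⟩ (V.filter fun s : Fin 24 => s.val < i) := by
    ext s
    simp only [mem_filter, mem_insert]
    constructor
    · rintro ⟨hs, hlt⟩
      by_cases he : s = ⟨i, hi⟩
      · exact Or.inl he
      · refine Or.inr ⟨hs, ?_⟩
        have : s.val ≠ i := fun h' => he (Fin.ext h')
        omega
    · rintro (he | ⟨hs, hlt⟩)
      · subst he
        exact ⟨h, Nat.lt_succ_self i⟩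
      · exact ⟨hs, by omega⟩
  rw [this, card_insert_of_notMem]
  simp

/-- elements below `i`, as a filter (non-member case). -/
theorem filter_lt_succ_of_not_mem {V : Finset (Fin 24)} {i : ℕ} (hi : i < 24) (h : (⟨i, hi⟩ : Fin 24) ∉ V) :
    (V.filter fun s : Fin 24 => s.val < i + 1) = V.filter fun s : Fin 24 => s.val < i := by
  ext s
  simp only [mem_filter]
  constructor
  · rintro ⟨hs, hlt⟩
    refine ⟨hs, ?_⟩
    rcases Nat.lt_succ_iff_lt_or_eq.1 hlt with hlt | he
    · exact hlt
    · exact absurd (by rw [show s = ⟨i, hi⟩ from Fin.ext he] at hs; exact hs) h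
  · rintro ⟨hs, hlt⟩
    exact ⟨hs, by omega⟩

/-- **soundness of the enumeration**: along the branch of a quad-free `16`-set `V` the enumeration reaches the leaf with mask `V`, whose
certificate carries `V` onto a representative. -/
theorem enumL_sound (V : Finset (Fin 24)) (hcard : V.card = 16)
    (hq : ∀ q ∈ quadT, ¬ (q.1 ∈ V ∧ q.2.1 ∈ V ∧ q.2.2.1 ∈ V ∧ q.2.2.2 ∈ V)) :
    ∀ (i : ℕ) (L : List (ℕ × ℕ × ℕ × ℕ)), L = idata.drop i → i ≤ 24 →
    ∀ (M cin cout N N' : ℕ), enumL L M cin cout N = some N' →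
    (∀ j, M.testBit j = true → ∃ h : j < 24, (⟨j, h⟩ : Fin 24) ∈ V ∧ j < i) →
    (∀ s ∈ V, (s : ℕ) < i → M.testBit s = true) →
    cin = (V.filter fun s : Fin 24 => s.val < i).card →
    cout = ((univ \ V).filter fun s : Fin 24 => s.val < i).card →
    ∃ (π ρ : Fin 24) (τ : Bool) (r : Fin 14), ∀ s' : Fin 24, repT r s' = true ↔ ∃ s ∈ V, actN π ρ τ s = s' := by
  intro i L
  induction L generalizing i with
  | nil =>
    intro hL hi M cin cout N N' hrun hM1 hM2 _ _
    -- `i = 24`: the mask is exactly `V`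
    have hi24 : i = 24 := by
      have := congrArg List.length hL
      rw [List.length_drop, idata_length, List.length_nil] at this
      omega
    subst hi24
    have hMV : ∀ s : Fin 24, M.testBit s = true ↔ s ∈ V := fun s =>
      ⟨fun h => by obtain ⟨h', hs, _⟩ := hM1 s h; exact hs, fun h => hM2 s h s.isLt⟩
    -- the leaf check
    simp only [enumL, leafCheck] at hrun
    split_ifs at hrun with h0 himg
    set c := decode (N % 16384 - 1)
    refine ⟨c.1, c.2.1, c.2.2.1, c.2.2.2, fun s' => ?_⟩
    rw [← repMask_spec, ← himg, testBit_imageMask]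
    constructor
    · rintro ⟨s, hs24, hsM, hact⟩
      exact ⟨⟨s, hs24⟩, (hMV ⟨s, hs24⟩).1 hsM, hact⟩
    · rintro ⟨s, hsV, hact⟩
      exact ⟨s, s.isLt, (hMV s).2 hsV, hact⟩
  | cons e L ih =>
    intro hL hi M cin cout N N' hrun hM1 hM2 hcin hcout
    -- `e` is the data of index `i < 24`
    have hi24 : i < 24 := by
      by_contra hge
      push Not at hge
      have := congrArg List.length hL
      rw [List.length_drop, idata_length, List.length_cons] at this
      omega
    have hget : idata.drop i = idata[i]'(by rw [idata_length]; exact hi24) :: idata.drop (i + 1) :=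
      List.drop_eq_getElem_cons _
    rw [hget] at hL
    obtain ⟨he, hL'⟩ := List.cons.inj hL
    have hei : e.1 = i := by
      have h1 : (idata.map Prod.fst)[i]'(by rw [List.length_map, idata_length]; exact hi24) = e.1 := by
        rw [List.getElem_map, ← he]
      rw [← h1]
      simp only [idata_fst, List.getElem_range]
    have hemem : e ∈ idata := by rw [he]; exact List.getElem_mem _
    simp only [enumL] at hrun
    by_cases hV : (⟨i, hi24⟩ : Fin 24) ∈ V
    · -- IN branch taken
      have hcin16 : cin < 16 := by
        rw [hcin, ← hcard]
        apply card_lt_card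
        refine Finset.filter_ssubset.2 ⟨⟨i, hi24⟩, hV, lt_irrefl _⟩
      have hcomp : completes e M = false := by
        by_contra hc
        rw [Bool.not_eq_false] at hc
        simp only [completes, Bool.or_eq_true, beq_iff_eq] at hc
        have aux : ∀ m ∈ [e.2.1, e.2.2.1, e.2.2.2], M &&& m = m → False := by
          intro m hm hand
          obtain ⟨q, hqT, hqi, hbits⟩ := idata_quads e hemem m hm
          apply hq q hqT
          have hin : ∀ j (hj : j < 24), IsCorner q j → (⟨j, hj⟩ : Fin 24) ∈ V := by
            intro j hj hc'
            by_cases hji : j = e.1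
            · have : (⟨j, hj⟩ : Fin 24) = ⟨i, hi24⟩ := Fin.ext (hji.trans hei)
              rw [this]; exact hV
            · have hmj := (hbits j hj).2 ⟨hc', hji⟩
              obtain ⟨h', hjV, _⟩ := hM1 j (testBit_of_and_eq hand hmj)
              exact hjV
          refine ⟨?_, ?_, ?_, ?_⟩
          · have := hin q.1 q.1.isLt (Or.inl rfl); simpa using this
          · have := hin q.2.1 q.2.1.isLt (Or.inr (Or.inl rfl)); simpa using this
          · have := hin q.2.2.1 q.2.2.1.isLt (Or.inr (Or.inr (Or.inl rfl))); simpa using this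
          · have := hin q.2.2.2 q.2.2.2.isLt (Or.inr (Or.inr (Or.inr rfl))); simpa using this
        rcases hc with (hc | hc) | hc
        · exact aux _ (by simp) hc
        · exact aux _ (by simp) hc
        · exact aux _ (by simp) hc
      rw [hcomp] at hrun
      simp only [hcin16, decide_true, Bool.not_false, Bool.and_self, if_true] at hrun
      -- the IN call returned `some`
      rcases hin1 : enumL L (M ||| 2 ^ e.1) (cin + 1) cout N with _ | N''
      · rw [hin1] at hrun; simp at hrun
      · refine ih (i + 1) hL' (by omega) (M ||| 2 ^ e.1) (cin + 1) cout N N'' hin1 ?_ ?_ ?_ ?_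
        · intro j hj
          rw [Nat.testBit_or, Bool.or_eq_true_iff] at hj
          rcases hj with hj | hj
          · obtain ⟨h', hjV, hlt⟩ := hM1 j hj
            exact ⟨h', hjV, by omega⟩
          · have hji : j = e.1 := by
              by_contra hne
              rw [Nat.testBit_two_pow_of_ne (Ne.symm hne)] at hj
              exact Bool.false_ne_true hj
            subst hji
            refine ⟨by rw [hei]; exact hi24, ?_, by rw [hei]; omega⟩
            have : (⟨e.1, by rw [hei]; exact hi24⟩ : Fin 24) = ⟨i, hi24⟩ := Fin.ext hei
            rw [this]; exact hV
        · intro s hs hlt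
          rw [Nat.testBit_or, Bool.or_eq_true_iff]
          rcases Nat.lt_succ_iff_lt_or_eq.1 hlt with hlt | heq
          · exact Or.inl (hM2 s hs hlt)
          · right
            rw [hei, ← heq, Nat.testBit_two_pow_self]
        · rw [card_filter_lt_succ_of_mem hi24 hV, hcin]
        · rw [hcout, filter_lt_succ_of_not_mem hi24 (by simp [hV])]
    · -- OUT branch
      have hcout8 : cout < 8 := by
        have hc8 : (univ \ V).card = 8 := by
          rw [card_sdiff]
          simp [hcard]
        rw [hcout, ← hc8]
        apply card_lt_card
        exact Finset.filter_ssubset.2 ⟨⟨i, hi24⟩, by simp [hV], lt_irrefl _⟩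
      -- whatever the IN branch did, the OUT call returned `some N'`
      have hout : ∃ N₀, enumL L M cin (cout + 1) N₀ = some N' := by
        by_cases hc : (cin < 16 && !completes e M) = true
        · rw [if_pos hc] at hrun
          rcases h1 : enumL L (M ||| 2 ^ e.1) (cin + 1) cout N with _ | N₀
          · rw [h1] at hrun; simp at hrun
          · rw [h1] at hrun
            simp only [hcout8, if_true] at hrun
            exact ⟨N₀, hrun⟩
        · rw [if_neg hc] at hrun
          simp only [hcout8, if_true] at hrun
          exact ⟨N, hrun⟩
      obtain ⟨N₀, hrun'⟩ := hout
      refine ih (i + 1) hL' (by omega) M cin (cout + 1) N₀ N' hrun' ?_ ?_ ?_ ?_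
      · intro j hj
        obtain ⟨h', hjV, hlt⟩ := hM1 j hj
        exact ⟨h', hjV, by omega⟩
      · intro s hs hlt
        rcases Nat.lt_succ_iff_lt_or_eq.1 hlt with hlt | heq
        · exact hM2 s hs hlt
        · exact absurd (by rw [show s = ⟨i, hi24⟩ from Fin.ext heq] at hs; exact hs) hV
      · rw [hcin, filter_lt_succ_of_not_mem hi24 hV]
      · rw [hcout, card_filter_lt_succ_of_mem hi24 (by simp [hV])]

/-- **THE ORBIT COVER.**  Every quad-free `16`-subset of `S₄` (as indices of `P24`) is carried by some `(π, ρ, τ)` onto one of the `14`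
representatives. -/
theorem cover (V : Finset (Fin 24)) (hcard : V.card = 16)
    (hq : ∀ q ∈ quadT, ¬ (q.1 ∈ V ∧ q.2.1 ∈ V ∧ q.2.2.1 ∈ V ∧ q.2.2.2 ∈ V)) :
    ∃ (π ρ : Fin 24) (τ : Bool) (r : Fin 14), ∀ s' : Fin 24, repT r s' = true ↔ ∃ s ∈ V, actN π ρ τ s = s' := by
  obtain ⟨N', hN'⟩ := Option.isSome_iff_exists.1 coverCheck
  exact enumL_sound V hcard hq 0 idata (by simp) (by norm_num) 0 0 0 certStream N' hN'
    (fun j hj => by simp at hj) (fun s _ h => absurd h (Nat.not_lt_zero _)) (by simp) (by simp)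

end Summit.ValiantsHypothesis.ValiantsHypothesis.Theorems.KPlusLogSqLaw.StaticFourQuad
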